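import Summits.RiemannHypothesis.RiemannHypothesis.Theorems.PfPersistenceLocalityBarrier
import Summits.RiemannHypothesis.RiemannHypothesis.Theorems.PfPersistenceTrigMomentUniqueness

/-!
# F5-INJ — within-range rigidity of the even block (fake seat 5, gen 4; RH-free, weight-free)

Mechanism / rigidity campaign `pub-rhpf` (FAKE SEAT 5, family F5 = prime-sum truncations and re-weightings);
**no RH claims** — nothing below mentions `RiemannHypothesis`, `ζ`'s positivity, or any served number.

`HOME/FAKES.md §5.1` states THEOREM F5-INJ informally (gen 0; RULING A16(b)): *within-range exact fakes do not
exist* — the even block `evenBlock w win` at ONE window `(a, N)` already determines the weight table `w` at every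
reached, non-degenerate position `q` (`2 ≤ q`, `log q < 2a`) as soon as `N` is at least the number of positions in
play; equivalently the locality wall W1 (`evenBlock_dial_of_not_mem`: a dial BEYOND `e^{2a}` is invisible) is
tight — INSIDE the range nothing can be hidden from a single window.  This file is the kernel form; the
trigonometric engine `trigMoment_eq_zero` is `PfPersistenceTrigMomentUniqueness.lean`.

* §2 the block entries as moment sums (`evenBlock_sub_apply`; row `0` carries the sine moments
  `Σ_q (w−w')(q) sin(m ω_q)`, the diagonal the weighted cosine moments `Σ_q (w−w')(q) (1 − log q / 2a) cos(m ω_q)`,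
  `ω_q = π log q / a ∈ (0, 2π)`).
* §3 **THEOREM F5-INJ** `weights_eq_of_evenBlock_eq`: `S ⊆ {q | 2 ≤ q ∧ log q < 2a}`, `#S ≤ N`, `w = w'` off `S`
  on `primeRange (2a)`, `evenBlock w win = evenBlock w' win` ⟹ `w = w'` on `S`; corollaries
  `weights_eq_on_primeRange_of_evenBlock_eq` and the single-dial form
  `evenBlock (dial p K w) win = evenBlock w win ↔ (K − 1) w p = 0`.
* §4 TIGHTNESS of the hypothesis `log q < 2a`: `thetaEven L n m L = 0`, so a weight sitting exactly at the endpoint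
  `q = e^{2a}` IS invisible (`evenBlock_congr_off_endpoint`, `evenBlock_dial_endpoint`; concretely `49 = 7²` at any
  window with `a = log 7`) — the one exact within-closed-range fake.

Labels: every `theorem` is PROVED here; nothing is DATA.
-/

set_option linter.dupNamespace false

noncomputable section

open Real Finset Matrix

namespace Summit.RiemannHypothesis.RiemannHypothesis.Theorems.PfPersistence

/-! ## §2 The even-block entries as moment sums -/

/-- PROVED: the difference of two even blocks is `−2 Σ_{q ≤ e^{2a}} (w − w')(q) θ_{nm}(log q)` — polar and
archimedean parts cancel. [folklore] -/
theorem evenBlock_sub_apply (w w' : Weights) (win : Window) (n m : Fin (win.N + 1)) :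
    evenBlock w win n m - evenBlock w' win n m
      = -(2 * ∑ q ∈ primeRange (2 * win.a), (w q - w' q) * thetaEven (2 * win.a) n m (Real.log q)) := by
  have h : ∑ q ∈ primeRange (2 * win.a), (w q - w' q) * thetaEven (2 * win.a) n m (Real.log q)
      = ∑ q ∈ primeRange (2 * win.a), w q * thetaEven (2 * win.a) n m (Real.log q)
        - ∑ q ∈ primeRange (2 * win.a), w' q * thetaEven (2 * win.a) n m (Real.log q) := by
    rw [← Finset.sum_sub_distrib]; exact Finset.sum_congr rfl fun q _ => by ring
  simp only [evenBlock, weil, WP]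
  rw [h]; ring

/-- PROVED: `log q < L ⟹ q ∈ primeRange L`. [folklore] -/
theorem mem_primeRange_of_log_lt {L : ℝ} {q : ℕ} (hq : Real.log q < L) : q ∈ primeRange L := by
  rw [primeRange, Finset.mem_range, Nat.lt_succ_iff]
  rcases Nat.eq_zero_or_pos q with h0 | hpos
  · simp [h0]
  · apply Nat.le_floor
    have hq' : (q : ℝ) = Real.exp (Real.log q) := (Real.exp_log (by exact_mod_cast hpos)).symm
    rw [hq']; exact Real.exp_le_exp.2 hq.le

/-- PROVED: equal blocks and agreement off `S ⊆ primeRange` ⟹ every `S`-restricted pattern sum of `w − w'`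
vanishes. [folklore] -/
theorem sum_thetaEven_eq_zero_of_evenBlock_eq (win : Window) {S : Finset ℕ}
    (hSsub : S ⊆ primeRange (2 * win.a)) {w w' : Weights}
    (hoff : ∀ q ∈ primeRange (2 * win.a), q ∉ S → w q = w' q) (heq : evenBlock w win = evenBlock w' win)
    (n m : Fin (win.N + 1)) :
    ∑ q ∈ S, (w q - w' q) * thetaEven (2 * win.a) n m (Real.log q) = 0 := by
  have h := evenBlock_sub_apply w w' win n m
  rw [heq, sub_self] at h
  have h' : ∑ q ∈ primeRange (2 * win.a), (w q - w' q) * thetaEven (2 * win.a) n m (Real.log q) = 0 := by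
    linarith
  rwa [← Finset.sum_subset hSsub (fun q hq hqS => by rw [hoff q hq hqS, sub_self, zero_mul])] at h'

/-- PROVED: row `0`, column `m ≥ 1` of the block difference is the SINE moment `Σ_{q∈S} (w−w')(q) sin(m ω_q)`,
`ω_q = π log q / a`. [folklore] -/
theorem sinMoment_eq_zero_of_evenBlock_eq (win : Window) {S : Finset ℕ}
    (hSsub : S ⊆ primeRange (2 * win.a)) {w w' : Weights}
    (hoff : ∀ q ∈ primeRange (2 * win.a), q ∉ S → w q = w' q) (heq : evenBlock w win = evenBlock w' win)
    (m : ℕ) (hm : m ≤ win.N) :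
    ∑ q ∈ S, (w q - w' q) * Real.sin (m * (π * Real.log q / win.a)) = 0 := by
  rcases Nat.eq_zero_or_pos m with hm0 | hmpos
  · simp [hm0]
  have ha : win.a ≠ 0 := ne_of_gt win.ha
  have h := sum_thetaEven_eq_zero_of_evenBlock_eq win hSsub hoff heq 0 ⟨m, by omega⟩
  have hθ : ∀ y : ℝ, thetaEven (2 * win.a) ((0 : Fin (win.N + 1)) : ℕ) ((⟨m, by omega⟩ : Fin (win.N + 1)) : ℕ) y
      = -Real.sin (2 * π * m * y / (2 * win.a)) / (Real.sqrt 2 * π * m) := by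
    intro y; simp [thetaEven, hmpos.ne']
  simp_rw [hθ] at h
  have hC : Real.sqrt 2 * π * m ≠ 0 := by positivity
  have key : ∑ q ∈ S, (w q - w' q) * Real.sin (m * (π * Real.log q / win.a))
      = -(Real.sqrt 2 * π * m)
        * ∑ q ∈ S, (w q - w' q) * (-Real.sin (2 * π * m * Real.log q / (2 * win.a)) / (Real.sqrt 2 * π * m)) := by
    rw [Finset.mul_sum]
    refine Finset.sum_congr rfl fun q _ => ?_
    rw [show 2 * π * (m : ℝ) * Real.log q / (2 * win.a) = m * (π * Real.log q / win.a) by field_simp]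
    field_simp
  rw [key, h, mul_zero]

/-- PROVED: the diagonal `(m, m)` (and `(0,0)`) of the block difference, corrected by the sine moment, is the
weighted COSINE moment `Σ_{q∈S} (w−w')(q) (1 − log q / 2a) cos(m ω_q)`. [folklore] -/
theorem cosMoment_eq_zero_of_evenBlock_eq (win : Window) {S : Finset ℕ}
    (hSsub : S ⊆ primeRange (2 * win.a)) {w w' : Weights}
    (hoff : ∀ q ∈ primeRange (2 * win.a), q ∉ S → w q = w' q) (heq : evenBlock w win = evenBlock w' win)
    (m : ℕ) (hm : m ≤ win.N) :
    ∑ q ∈ S, (w q - w' q) * ((2 * win.a - Real.log q) / (2 * win.a))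
      * Real.cos (m * (π * Real.log q / win.a)) = 0 := by
  have ha : win.a ≠ 0 := ne_of_gt win.ha
  rcases Nat.eq_zero_or_pos m with hm0 | hmpos
  · -- the `(0,0)` entry: `θ₀₀(y) = (L − y)/L`
    have h := sum_thetaEven_eq_zero_of_evenBlock_eq win hSsub hoff heq 0 0
    have hθ : ∀ y : ℝ, thetaEven (2 * win.a) ((0 : Fin (win.N + 1)) : ℕ) ((0 : Fin (win.N + 1)) : ℕ) y
        = (2 * win.a - y) / (2 * win.a) := by
      intro y; simp [thetaEven]
    simp_rw [hθ] at h
    simpa [hm0] using h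
  · -- the `(m,m)` entry: `θ_mm(y) = (L − y)/L cos(2πmy/L) − sin(2πmy/L)/(2πm)`
    have h := sum_thetaEven_eq_zero_of_evenBlock_eq win hSsub hoff heq ⟨m, by omega⟩ ⟨m, by omega⟩
    have hθ : ∀ y : ℝ,
        thetaEven (2 * win.a) ((⟨m, by omega⟩ : Fin (win.N + 1)) : ℕ) ((⟨m, by omega⟩ : Fin (win.N + 1)) : ℕ) y
        = (2 * win.a - y) / (2 * win.a) * Real.cos (2 * π * m * y / (2 * win.a))
          - Real.sin (2 * π * m * y / (2 * win.a)) / (2 * π * m) := by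
      intro y; simp [thetaEven, hmpos.ne']
    simp_rw [hθ] at h
    have hs := sinMoment_eq_zero_of_evenBlock_eq win hSsub hoff heq m hm
    have harg : ∀ q : ℕ, 2 * π * (m : ℝ) * Real.log q / (2 * win.a) = m * (π * Real.log q / win.a) := by
      intro q; field_simp
    simp_rw [harg] at h
    have key : ∑ q ∈ S, (w q - w' q) * ((2 * win.a - Real.log q) / (2 * win.a))
          * Real.cos (m * (π * Real.log q / win.a))
        = ∑ q ∈ S, (w q - w' q) * ((2 * win.a - Real.log q) / (2 * win.a) * Real.cos (m * (π * Real.log q / win.a))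
            - Real.sin (m * (π * Real.log q / win.a)) / (2 * π * m))
          + (1 / (2 * π * m)) * ∑ q ∈ S, (w q - w' q) * Real.sin (m * (π * Real.log q / win.a)) := by
      rw [Finset.mul_sum, ← Finset.sum_add_distrib]
      refine Finset.sum_congr rfl fun q _ => ?_
      have hC : (2 * π * m : ℝ) ≠ 0 := by positivity
      field_simp
      ring
    rw [key, h, hs, mul_zero, add_zero]

/-! ## §3 THEOREM F5-INJ: one window determines the within-range weights -/

/-- **THEOREM F5-INJ (PROVED; FAKES.md §5.1, RULING A16(b)).** Let `S` be a set of reached, non-degenerate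
positions (`2 ≤ q`, `log q < 2a`) with `#S ≤ N`.  If two weight tables agree off `S` on `primeRange (2a)` and have
the SAME even block at the one window `(a, N)`, they agree on `S` too.  Within-range exact fakes do not exist; the
locality wall `e^{2a}` (`evenBlock_dial_of_not_mem`) is the only place to hide an arithmetic perturbation from a
window.  RH-free, weight-free (no hypothesis on `w`, `w'`). [folklore] -/
theorem weights_eq_of_evenBlock_eq (win : Window) {S : Finset ℕ}
    (hS : ∀ q ∈ S, 2 ≤ q ∧ Real.log q < 2 * win.a) (hcard : S.card ≤ win.N) {w w' : Weights}
    (hoff : ∀ q ∈ primeRange (2 * win.a), q ∉ S → w q = w' q) (heq : evenBlock w win = evenBlock w' win) :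
    ∀ q ∈ S, w q = w' q := by
  have ha := win.ha
  have hSsub : S ⊆ primeRange (2 * win.a) := fun q hq => mem_primeRange_of_log_lt (hS q hq).2
  have hpos : ∀ q ∈ S, (0 : ℝ) < q := fun q hq => by
    have := (hS q hq).1; exact_mod_cast (show 0 < q by omega)
  have hlog : ∀ q ∈ S, 0 < Real.log q := fun q hq =>
    Real.log_pos (by have := (hS q hq).1; exact_mod_cast (show 1 < q by omega))
  have hzero := trigMoment_eq_zero S (fun q => π * Real.log q / win.a) (fun q => w q - w' q)
    (fun q => (2 * win.a - Real.log q) / (2 * win.a)) win.N ?_ ?_ ?_ hcard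
    (fun m hm => sinMoment_eq_zero_of_evenBlock_eq win hSsub hoff heq m hm)
    (fun m hm => cosMoment_eq_zero_of_evenBlock_eq win hSsub hoff heq m hm)
  · intro q hq; exact sub_eq_zero.1 (hzero q hq)
  · -- injectivity of `q ↦ π log q / a` on `S`
    intro q hq q' hq' h
    have h1 : Real.log q = Real.log q' := by
      have h2 : π * Real.log q = π * Real.log q' := by
        have := congrArg (fun t => t * win.a) h
        simpa [div_mul_cancel₀, ne_of_gt ha] using this
      exact mul_left_cancel₀ (ne_of_gt Real.pi_pos) h2
    have h3 : (q : ℝ) = q' := Real.log_injOn_pos (hpos q hq) (hpos q' hq') h1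
    exact_mod_cast h3
  · intro q hq
    refine ⟨div_pos (mul_pos Real.pi_pos (hlog q hq)) ha, ?_⟩
    rw [div_lt_iff₀ ha]
    have := mul_lt_mul_of_pos_left (hS q hq).2 Real.pi_pos
    linarith
  · intro q hq
    exact div_pos (sub_pos.2 (hS q hq).2) (by linarith)

/-- PROVED (corollary): under the hypotheses of F5-INJ the two tables agree on the WHOLE reached range. [folklore] -/
theorem weights_eq_on_primeRange_of_evenBlock_eq (win : Window) {S : Finset ℕ}
    (hS : ∀ q ∈ S, 2 ≤ q ∧ Real.log q < 2 * win.a) (hcard : S.card ≤ win.N) {w w' : Weights}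
    (hoff : ∀ q ∈ primeRange (2 * win.a), q ∉ S → w q = w' q) (heq : evenBlock w win = evenBlock w' win) :
    ∀ q ∈ primeRange (2 * win.a), w q = w' q := by
  classical
  intro q hq
  by_cases hqS : q ∈ S
  · exact weights_eq_of_evenBlock_eq win hS hcard hoff heq q hqS
  · exact hoff q hq hqS

/-- PROVED (single-dial form of F5-INJ): at a window reaching the non-degenerate position `p` (`2 ≤ p`,
`log p < 2a`, `N ≥ 1`) a `p`-dial is invisible iff it does nothing: `K = 1` or `w p = 0`.  (`←` is
`evenBlock_dial_eq`; `→` is the theorem.) [folklore] -/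
theorem evenBlock_dial_eq_self_iff {p : ℕ} {win : Window} (hp : 2 ≤ p) (hpa : Real.log p < 2 * win.a)
    (hN : 1 ≤ win.N) (K : ℝ) (w : Weights) :
    evenBlock (dial p K w) win = evenBlock w win ↔ (K - 1) * w p = 0 := by
  classical
  constructor
  · intro h
    have hmain := weights_eq_of_evenBlock_eq win (S := {p})
      (fun q hq => by rw [Finset.mem_singleton] at hq; subst hq; exact ⟨hp, hpa⟩)
      (by simpa using hN) (w := dial p K w) (w' := w)
      (fun q _ hq => by
        have hqp : q ≠ p := by simpa using hq
        simp [dial, hqp]) h p (Finset.mem_singleton_self p)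
    simp [dial] at hmain
    linear_combination hmain
  · intro h
    rw [evenBlock_dial_eq (mem_primeRange_of_log_lt hpa), show 2 * (K - 1) * w p = 2 * ((K - 1) * w p) by ring,
      h, mul_zero, zero_smul, sub_zero]

/-! ## §4 Tightness of `log q < 2a`: the endpoint atom is invisible -/

/-- PROVED: every even-block pattern vanishes at the endpoint `y = L` (`L ≠ 0`). [folklore] -/
theorem thetaEven_apply_length {L : ℝ} (hL : L ≠ 0) (n m : ℕ) : thetaEven L n m L = 0 := by
  have h1 : ∀ k : ℕ, Real.sin (2 * π * k) = 0 := by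
    intro k
    rw [show 2 * π * (k : ℝ) = ((2 * k : ℕ) : ℝ) * π by push_cast; ring]
    exact Real.sin_nat_mul_pi _
  unfold thetaEven
  split_ifs <;> simp [h1, hL]

/-- **PROVED (TIGHTNESS of F5-INJ).** Two weight tables that agree on `primeRange (2a)` except possibly AT the
endpoint position `log q = 2a` have the same even block: a weight sitting exactly at `q = e^{2a}` is invisible to
the window `(a, N)` for every `N` — the one exact "within-closed-range" fake, and the reason the hypothesis
`log q < 2a` of `weights_eq_of_evenBlock_eq` cannot be weakened to `≤`. [folklore] -/
theorem evenBlock_congr_off_endpoint (win : Window) {w w' : Weights}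
    (h : ∀ q ∈ primeRange (2 * win.a), Real.log q ≠ 2 * win.a → w q = w' q) :
    evenBlock w win = evenBlock w' win := by
  ext n m
  have hsub := evenBlock_sub_apply w w' win n m
  have h0 : ∑ q ∈ primeRange (2 * win.a), (w q - w' q) * thetaEven (2 * win.a) n m (Real.log q) = 0 := by
    refine Finset.sum_eq_zero fun q hq => ?_
    by_cases hq' : Real.log q = 2 * win.a
    · rw [hq', thetaEven_apply_length (ne_of_gt (by linarith [win.ha])) n m, mul_zero]
    · rw [h q hq hq', sub_self, zero_mul]
  rw [h0, mul_zero, neg_zero] at hsub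
  linarith

/-- PROVED: a dial (in particular the deletion `K = 0`) AT the endpoint position `log q₀ = 2a` is invisible.
[folklore] -/
theorem evenBlock_dial_endpoint (win : Window) {q₀ : ℕ} (hq₀ : Real.log q₀ = 2 * win.a) (K : ℝ) (w : Weights) :
    evenBlock (dial q₀ K w) win = evenBlock w win :=
  evenBlock_congr_off_endpoint win fun q _ hq => by
    have hne : q ≠ q₀ := fun h' => hq (h' ▸ hq₀)
    simp [dial, hne]

/-- PROVED (concrete instance): at any window with `a = log 7` the prime power `49 = 7²` sits exactly at the
endpoint `e^{2a}`, so deleting or re-weighting it is invisible to the `(log 7, N)` block for EVERY `N`. [folklore] -/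
theorem evenBlock_dial_49_of_a_eq_log7 (win : Window) (hwin : win.a = Real.log 7) (K : ℝ) (w : Weights) :
    evenBlock (dial 49 K w) win = evenBlock w win := by
  refine evenBlock_dial_endpoint win ?_ K w
  rw [hwin, show ((49 : ℕ) : ℝ) = (7 : ℝ) ^ 2 by norm_num, Real.log_pow]
  push_cast
  ring

end Summit.RiemannHypothesis.RiemannHypothesis.Theorems.PfPersistence
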